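import Literature.MathematicalPhysics.KineticTheory.PrefixRungScaleCloseness
import Literature.MathematicalPhysics.KineticTheory.DampedHarmonicBlockObservability
import HarnessLib

/-!
# The energy of the prefix cell chain, block by block: cell block at scale `K⁴`, harmonic corrections, host block

Trunk T-KINETIC (Literature/MathematicalPhysics/KineticTheory). For the MIXED rung
`cellChain ω₂ lam β γ (· < k)` on `N = k + 1 + n` sites (cell block `[0, k]` = the sites
`Fin.castAdd n i`, `i : Fin (k+1)`; host block = the sites `Fin.natAdd (k+1) j`, `j : Fin n`) the
Hamiltonian splits EXACTLY as

`H(w) = K⁴ · Ĥ₀(π(rescale K w)) + cellHarm(w) + hostEnergy(w)`,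

where `Ĥ₀` is the energy of the limit cell chain of `PrefixRungScaling.lean` (kinetic energy of the
cell block, quartic pinning on `[0, k)`, quartic cell bonds), `cellHarm` collects the degree-2 terms of
the cell block (harmonic pinning `ω₂q²/2` on `[0, k]`, harmonic parts `r²/2` of the cell bonds) and
`hostEnergy` the host block (kinetic, harmonic pinning, its harmonic bonds, and the harmonic
interface bond `k`). This is the bookkeeping behind the two regimes of the high-energy dissipation
estimate for the mixed rung (crux `PrefixSteadyStates` of `AtomisticToContinuum/FouriersLaw`): at
energy `K⁴` with cell positions `O(K)`, `cellHarm = O(K²)`, so EITHER the rescaled cell energy `Ĥ₀` is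
bounded below OR the host block carries a definite fraction of `K⁴`, and then so does
`∑_host (q² + p²)` (`hostEnergy ≤ (ω₂/2 + 4) ∑_host (q² + p²) + q_k²`).

* `sum_sum_ite_succ_eq_sum_dite` — the bond double sum as a single sum over the left endpoints;
* `prefixCellHarm`, `prefixHostEnergy` (definitions) and `prefixRung_hamiltonian_split` (the identity);
* `prefixLimit_hamiltonian_proj_rescale_le` — `Ĥ₀(π(rescale K w)) ≤ K⁻⁴ H(w)`;
* `prefixCellHarm_le`, `prefixHostEnergy_le_sum_sq` — the two bounds above.

## References

* N. Cuneo, J.-P. Eckmann, M. Hairer, L. Rey-Bellet, EJP 23 (2018) no. 55, §5.1 (the rescaled energy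
  (5.9)) and Remark 2.11 (mixed degrees).
* F. Bonetto, J. L. Lebowitz, L. Rey-Bellet, in *Mathematical Physics 2000*, §3 eq. (8).
-/

noncomputable section

open MeasureTheory Filter Topology Set Metric Function Finset
open scoped NNReal

namespace Literature.MathematicalPhysics.KineticTheory.HeatConduction

open OscillatorChain

/-! ### Bond sums as single sums -/

/-- The nearest-neighbour double sum `∑_i ∑_j [j = i+1] g i j` is the single sum
`∑_i [i+1 < N] g i (i+1)` over the left endpoints. [folklore] -/
theorem sum_sum_ite_succ_eq_sum_dite {N : ℕ} (g : Fin N → Fin N → ℝ) :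
    ∑ i : Fin N, ∑ j : Fin N, (if j.val = i.val + 1 then g i j else 0) =
      ∑ i : Fin N, (if h : i.val + 1 < N then g i ⟨i.val + 1, h⟩ else 0) := by
  refine Finset.sum_congr rfl fun i _ => ?_
  by_cases h : i.val + 1 < N
  · rw [dif_pos h, Finset.sum_eq_single_of_mem (⟨i.val + 1, h⟩ : Fin N) (Finset.mem_univ _)]
    · simp
    · intro j _ hj
      rw [if_neg]
      intro hj'
      exact hj (Fin.ext hj')
  · rw [dif_neg h]
    refine Finset.sum_eq_zero fun j _ => ?_
    rw [if_neg]
    intro hj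
    exact h (hj ▸ j.isLt)

/-! ### The two correction energies -/

section Blocks

variable (ω₂ : ℝ) (k n : ℕ)

/-- The **harmonic energy of the cell block** of the prefix rung on `k + 1 + n` sites: the harmonic
pinning `ω₂ qᵢ²/2` of the cell sites `i ≤ k` and the harmonic parts `(qᵢ₊₁ - qᵢ)²/2` of the cell bonds
`i < k`. [folklore] -/
def prefixCellHarm (w : PhaseSpace (k + 1 + n)) : ℝ :=
  (∑ i : Fin (k + 1), ω₂ * w.1 (Fin.castAdd n i) ^ 2 / 2) +
    ∑ i : Fin (k + 1), if h : i.val + 1 < k + 1 then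
      (w.1 (Fin.castAdd n ⟨i.val + 1, h⟩) - w.1 (Fin.castAdd n i)) ^ 2 / 2 else 0

/-- The **energy of the host block** of the prefix rung on `k + 1 + n` sites: kinetic and harmonic
pinning energy of the host sites `k + 1 + j`, the harmonic host bonds, and the harmonic INTERFACE
bond between the last cell site `k` and the first host site `k + 1` (present iff `n > 0`). [folklore] -/
def prefixHostEnergy (w : PhaseSpace (k + 1 + n)) : ℝ :=
  (∑ j : Fin n, (w.2 (Fin.natAdd (k + 1) j) ^ 2 / 2 + ω₂ * w.1 (Fin.natAdd (k + 1) j) ^ 2 / 2)) +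
    (∑ j : Fin n, if h : j.val + 1 < n then
      (w.1 (Fin.natAdd (k + 1) ⟨j.val + 1, h⟩) - w.1 (Fin.natAdd (k + 1) j)) ^ 2 / 2 else 0) +
    (if h : 0 < n then (w.1 (Fin.natAdd (k + 1) ⟨0, h⟩) - w.1 (Fin.castAdd n (Fin.last k))) ^ 2 / 2 else 0)

variable {ω₂ k n}

/-- The harmonic cell energy is nonnegative (`ω₂ ≥ 0`). [folklore] -/
theorem prefixCellHarm_nonneg (hω : 0 ≤ ω₂) (w : PhaseSpace (k + 1 + n)) : 0 ≤ prefixCellHarm ω₂ k n w := by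
  unfold prefixCellHarm
  refine add_nonneg (Finset.sum_nonneg fun i _ => by positivity) (Finset.sum_nonneg fun i _ => ?_)
  split_ifs <;> positivity

/-- The host energy is nonnegative (`ω₂ ≥ 0`). [folklore] -/
theorem prefixHostEnergy_nonneg (hω : 0 ≤ ω₂) (w : PhaseSpace (k + 1 + n)) : 0 ≤ prefixHostEnergy ω₂ k n w := by
  unfold prefixHostEnergy
  refine add_nonneg (add_nonneg (Finset.sum_nonneg fun j _ => by positivity)
    (Finset.sum_nonneg fun j _ => ?_)) ?_
  · split_ifs <;> positivity
  · split_ifs <;> positivity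

end Blocks

/-! ### The exact splitting of the Hamiltonian -/

section Split

/- The limit cell chain of the prefix rung, as a structure literal (notation only, as in
`PrefixRungScaling.lean`). -/
set_option quotPrecheck false in
local notation "P₀⟦" lam ", " β ", " k "⟧" =>
  (SiteChain.mk (fun i q => (if i < k then lam else 0) * q ^ 4 / 4) (fun _ r => β * r ^ 4 / 4) 0)

variable {ω₂ lam β γ K : ℝ} {k n : ℕ}

/-- `Fin.castLE` onto the first `k + 1` of `k + 1 + n` sites is `Fin.castAdd`. [folklore] -/
theorem castLE_eq_castAdd (h : k + 1 ≤ k + 1 + n) (i : Fin (k + 1)) : Fin.castLE h i = Fin.castAdd n i :=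
  Fin.ext rfl

/-- **The energy of the limit cell chain at the projected rescaled point, times `K⁴`, is the cell
block's kinetic energy plus its quartic pinning and quartic bond energy** (`K ≠ 0`). [folklore] -/
theorem prefixLimit_hamiltonian_proj_rescale_mul (hK : K ≠ 0) (h : k + 1 ≤ k + 1 + n)
    (w : PhaseSpace (k + 1 + n)) :
    K ^ 4 * P₀⟦lam, β, k⟧.hamiltonian (k + 1) (prefixRungProj k (k + 1 + n) h (rescale K w)) =
      (∑ i : Fin (k + 1), (w.2 (Fin.castAdd n i) ^ 2 / 2 +
          (if i.val < k then lam else 0) * w.1 (Fin.castAdd n i) ^ 4 / 4)) +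
        ∑ i : Fin (k + 1), if h : i.val + 1 < k + 1 then
          β * (w.1 (Fin.castAdd n ⟨i.val + 1, h⟩) - w.1 (Fin.castAdd n i)) ^ 4 / 4 else 0 := by
  rw [prefixLimit_hamiltonian_eq, sum_sum_ite_succ_eq_sum_dite, mul_add, Finset.mul_sum, Finset.mul_sum]
  have hK2 : K ^ 2 ≠ 0 := pow_ne_zero 2 hK
  congr 1
  · refine Finset.sum_congr rfl fun i _ => ?_
    simp only [prefixRungProj_fst, prefixRungProj_snd, rescale_fst, rescale_snd, castLE_eq_castAdd]
    field_simp
  · refine Finset.sum_congr rfl fun i _ => ?_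
    split_ifs with hi
    · simp only [prefixRungProj_fst, rescale_fst, castLE_eq_castAdd]
      field_simp
    · rw [mul_zero]

/-- **The exact splitting of the energy of the prefix rung** on `N = k + 1 + n` sites:
`H(w) = K⁴ Ĥ₀(π(rescale K w)) + cellHarm(w) + hostEnergy(w)` (`K ≠ 0`). [folklore] -/
theorem prefixRung_hamiltonian_split (hK : K ≠ 0) (h : k + 1 ≤ k + 1 + n) (w : PhaseSpace (k + 1 + n)) :
    (cellChain ω₂ lam β γ (fun i => decide (i < k))).hamiltonian (k + 1 + n) w =
      K ^ 4 * P₀⟦lam, β, k⟧.hamiltonian (k + 1) (prefixRungProj k (k + 1 + n) h (rescale K w)) +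
        prefixCellHarm ω₂ k n w + prefixHostEnergy ω₂ k n w := by
  rw [prefixLimit_hamiltonian_proj_rescale_mul hK h]
  -- expand the Hamiltonian of the rung and split every sum into its cell and host parts
  have hH : (cellChain ω₂ lam β γ (fun i => decide (i < k))).hamiltonian (k + 1 + n) w =
      (∑ i : Fin (k + 1 + n), (w.2 i ^ 2 / 2 +
        (ω₂ * w.1 i ^ 2 / 2 + (if decide (i.val < k) then lam else 0) * w.1 i ^ 4 / 4))) +
      ∑ i : Fin (k + 1 + n), (if h : i.val + 1 < k + 1 + n then
        ((w.1 ⟨i.val + 1, h⟩ - w.1 i) ^ 2 / 2 +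
          (if decide (i.val < k) then β else 0) * (w.1 ⟨i.val + 1, h⟩ - w.1 i) ^ 4 / 4) else 0) := by
    show (∑ i : Fin (k + 1 + n), (w.2 i ^ 2 / 2 +
        (ω₂ * w.1 i ^ 2 / 2 + (if decide (i.val < k) then lam else 0) * w.1 i ^ 4 / 4))) +
      ∑ i : Fin (k + 1 + n), ∑ j : Fin (k + 1 + n), (if j.val = i.val + 1 then
        ((w.1 j - w.1 i) ^ 2 / 2 + (if decide (i.val < k) then β else 0) * (w.1 j - w.1 i) ^ 4 / 4) else 0) = _
    rw [sum_sum_ite_succ_eq_sum_dite]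
  rw [hH, Fin.sum_univ_add (a := k + 1) (b := n), Fin.sum_univ_add (a := k + 1) (b := n)]
  -- the cell sites
  have hcs : ∀ i : Fin (k + 1), (decide ((Fin.castAdd n i).val < k) = true) = (i.val < k) := fun i => by
    simp [Fin.val_castAdd]
  -- the host sites: no quartic term, no cell indicator
  have hhs : ∀ j : Fin n, ¬ ((Fin.natAdd (k + 1) j).val < k) := fun j => by
    simp only [Fin.val_natAdd, not_lt]; omega
  -- bonds from a cell site
  have hcb : ∀ i : Fin (k + 1), (if h : (Fin.castAdd n i).val + 1 < k + 1 + n then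
        ((w.1 ⟨(Fin.castAdd n i).val + 1, h⟩ - w.1 (Fin.castAdd n i)) ^ 2 / 2 +
          (if decide ((Fin.castAdd n i).val < k) then β else 0) *
            (w.1 ⟨(Fin.castAdd n i).val + 1, h⟩ - w.1 (Fin.castAdd n i)) ^ 4 / 4) else 0) =
      ((if h : i.val + 1 < k + 1 then
          (w.1 (Fin.castAdd n ⟨i.val + 1, h⟩) - w.1 (Fin.castAdd n i)) ^ 2 / 2 else 0) +
        (if h : i.val + 1 < k + 1 then
          β * (w.1 (Fin.castAdd n ⟨i.val + 1, h⟩) - w.1 (Fin.castAdd n i)) ^ 4 / 4 else 0)) +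
        (if i.val = k then (if h : 0 < n then
          (w.1 (Fin.natAdd (k + 1) ⟨0, h⟩) - w.1 (Fin.castAdd n (Fin.last k))) ^ 2 / 2 else 0) else 0) := by
    intro i
    by_cases hi : i.val < k
    · -- an interior cell bond
      have h1 : (Fin.castAdd n i).val + 1 < k + 1 + n := by simp; omega
      have h2 : i.val + 1 < k + 1 := by omega
      have h3 : i.val ≠ k := by omega
      have e : (⟨(Fin.castAdd n i).val + 1, h1⟩ : Fin (k + 1 + n)) = Fin.castAdd n ⟨i.val + 1, h2⟩ :=
        Fin.ext (by simp)
      rw [dif_pos h1, dif_pos h2, dif_pos h2, if_neg h3, e, if_pos (by simpa using hi), add_zero]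
    · -- the interface bond from the last cell site `k`
      have hik : i.val = k := by omega
      have h2 : ¬ (i.val + 1 < k + 1) := by omega
      have hil : i = Fin.last k := Fin.ext (by simp [hik])
      rw [dif_neg h2, dif_neg h2, if_pos hik, add_zero, zero_add]
      by_cases hn : 0 < n
      · have h1 : (Fin.castAdd n i).val + 1 < k + 1 + n := by simp; omega
        have e : (⟨(Fin.castAdd n i).val + 1, h1⟩ : Fin (k + 1 + n)) = Fin.natAdd (k + 1) ⟨0, hn⟩ :=
          Fin.ext (by simp; omega)
        rw [dif_pos h1, dif_pos hn, e, if_neg (by simpa using hi), hil]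
        ring
      · have h1 : ¬ ((Fin.castAdd n i).val + 1 < k + 1 + n) := by simp; omega
        rw [dif_neg h1, dif_neg hn]
  -- bonds from a host site
  have hhb : ∀ j : Fin n, (if h : (Fin.natAdd (k + 1) j).val + 1 < k + 1 + n then
        ((w.1 ⟨(Fin.natAdd (k + 1) j).val + 1, h⟩ - w.1 (Fin.natAdd (k + 1) j)) ^ 2 / 2 +
          (if decide ((Fin.natAdd (k + 1) j).val < k) then β else 0) *
            (w.1 ⟨(Fin.natAdd (k + 1) j).val + 1, h⟩ - w.1 (Fin.natAdd (k + 1) j)) ^ 4 / 4) else 0) =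
      (if h : j.val + 1 < n then
        (w.1 (Fin.natAdd (k + 1) ⟨j.val + 1, h⟩) - w.1 (Fin.natAdd (k + 1) j)) ^ 2 / 2 else 0) := by
    intro j
    by_cases hj : j.val + 1 < n
    · have h1 : (Fin.natAdd (k + 1) j).val + 1 < k + 1 + n := by simp; omega
      have e : (⟨(Fin.natAdd (k + 1) j).val + 1, h1⟩ : Fin (k + 1 + n)) = Fin.natAdd (k + 1) ⟨j.val + 1, hj⟩ :=
        Fin.ext (by simp; omega)
      rw [dif_pos h1, dif_pos hj, e, if_neg (by simpa using hhs j)]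
      ring
    · have h1 : ¬ ((Fin.natAdd (k + 1) j).val + 1 < k + 1 + n) := by simp; omega
      rw [dif_neg h1, dif_neg hj]
  rw [Finset.sum_congr rfl (fun i _ => hcb i), Finset.sum_congr rfl (fun j _ => hhb j)]
  have hhs' : ∀ j : Fin n, (if decide ((Fin.natAdd (k + 1) j).val < k) then lam else 0) *
      w.1 (Fin.natAdd (k + 1) j) ^ 4 / 4 = 0 := fun j => by
    rw [if_neg (by simpa using hhs j)]; ring
  simp only [hcs, hhs', Finset.sum_add_distrib, add_zero]
  -- the interface term: a sum over `i : Fin (k+1)` of `[i = k] X` is `X`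
  have hint : ∑ i : Fin (k + 1), (if i.val = k then (if h : 0 < n then
      (w.1 (Fin.natAdd (k + 1) ⟨0, h⟩) - w.1 (Fin.castAdd n (Fin.last k))) ^ 2 / 2 else 0) else 0) =
      (if h : 0 < n then (w.1 (Fin.natAdd (k + 1) ⟨0, h⟩) - w.1 (Fin.castAdd n (Fin.last k))) ^ 2 / 2 else 0) := by
    rw [Finset.sum_eq_single_of_mem (Fin.last k) (Finset.mem_univ _)]
    · simp
    · intro i _ hi
      rw [if_neg]
      intro h
      exact hi (Fin.ext (by simp [h]))
  rw [hint]
  unfold prefixCellHarm prefixHostEnergy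
  simp only [Finset.sum_add_distrib]
  -- `ring` with the dependent `if` as an atom
  generalize (if h : 0 < n then (w.1 (Fin.natAdd (k + 1) ⟨0, h⟩) - w.1 (Fin.castAdd n (Fin.last k))) ^ 2 / 2
    else (0 : ℝ)) = I
  ring

/-- **The rescaled limit energy of the cell block is at most `K⁻⁴ H`** (`ω₂ ≥ 0`, `K ≠ 0`). [folklore] -/
theorem prefixLimit_hamiltonian_proj_rescale_le (hω : 0 ≤ ω₂) (hK : K ≠ 0) (h : k + 1 ≤ k + 1 + n)
    (w : PhaseSpace (k + 1 + n)) :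
    P₀⟦lam, β, k⟧.hamiltonian (k + 1) (prefixRungProj k (k + 1 + n) h (rescale K w)) ≤
      (K ^ 4)⁻¹ * (cellChain ω₂ lam β γ (fun i => decide (i < k))).hamiltonian (k + 1 + n) w := by
  rw [prefixRung_hamiltonian_split hK h w]
  have h1 := prefixCellHarm_nonneg (k := k) (n := n) hω w
  have h2 := prefixHostEnergy_nonneg (k := k) (n := n) hω w
  have hK4 : 0 < K ^ 4 := by positivity
  rw [le_inv_mul_iff₀ hK4]
  linarith

/-! ### The two bounds: the harmonic cell energy is `O(K²)`, the host energy is controlled by `∑_host (q² + p²)` -/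

/-- **The harmonic cell energy is `O(K²)` at energy `O(K⁴)`**: if `|qᵢ| ≤ Cq K` on the cell block then
`cellHarm(w) ≤ (k + 1) (ω₂/2 + 2) Cq² K²` (`ω₂ ≥ 0`). [folklore] -/
theorem prefixCellHarm_le (hω : 0 ≤ ω₂) {K Cq : ℝ} (w : PhaseSpace (k + 1 + n))
    (hq : ∀ i : Fin (k + 1), |w.1 (Fin.castAdd n i)| ≤ Cq * K) :
    prefixCellHarm ω₂ k n w ≤ (k + 1) * (ω₂ / 2 + 2) * Cq ^ 2 * K ^ 2 := by
  unfold prefixCellHarm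
  have hsq : ∀ i : Fin (k + 1), w.1 (Fin.castAdd n i) ^ 2 ≤ (Cq * K) ^ 2 := fun i => by
    rw [← sq_abs]; exact pow_le_pow_left₀ (abs_nonneg _) (hq i) 2
  have hCK : 0 ≤ Cq * K := (abs_nonneg _).trans (hq 0)
  have h1 : ∑ i : Fin (k + 1), ω₂ * w.1 (Fin.castAdd n i) ^ 2 / 2 ≤ ∑ _i : Fin (k + 1), ω₂ * (Cq * K) ^ 2 / 2 :=
    Finset.sum_le_sum fun i _ => by
      have := hsq i
      have : ω₂ * w.1 (Fin.castAdd n i) ^ 2 ≤ ω₂ * (Cq * K) ^ 2 := mul_le_mul_of_nonneg_left this hω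
      linarith
  have h2 : ∑ i : Fin (k + 1), (if h : i.val + 1 < k + 1 then
      (w.1 (Fin.castAdd n ⟨i.val + 1, h⟩) - w.1 (Fin.castAdd n i)) ^ 2 / 2 else 0) ≤
      ∑ _i : Fin (k + 1), 2 * (Cq * K) ^ 2 := Finset.sum_le_sum fun i _ => by
    split_ifs with h
    · have ha := hq ⟨i.val + 1, h⟩
      have hb := hq i
      have hab : |w.1 (Fin.castAdd n ⟨i.val + 1, h⟩) - w.1 (Fin.castAdd n i)| ≤ 2 * (Cq * K) :=
        (abs_sub _ _).trans (by linarith)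
      have : (w.1 (Fin.castAdd n ⟨i.val + 1, h⟩) - w.1 (Fin.castAdd n i)) ^ 2 ≤ (2 * (Cq * K)) ^ 2 := by
        rw [← sq_abs]; exact pow_le_pow_left₀ (abs_nonneg _) hab 2
      nlinarith
    · positivity
  rw [Finset.sum_const, Finset.card_univ, Fintype.card_fin, nsmul_eq_mul] at h1 h2
  push_cast at h1 h2
  nlinarith [h1, h2, sq_nonneg (Cq * K)]

/-- **The host energy is controlled by `∑_host (q² + p²)` and the interface position**:
`hostEnergy(w) ≤ (ω₂/2 + 4) ∑_j (q_{k+1+j}² + p_{k+1+j}²) + q_k²` (`ω₂ ≥ 0`). [folklore] -/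
theorem prefixHostEnergy_le_sum_sq (hω : 0 ≤ ω₂) (w : PhaseSpace (k + 1 + n)) :
    prefixHostEnergy ω₂ k n w ≤
      (ω₂ / 2 + 4) * (∑ j : Fin n, (w.1 (Fin.natAdd (k + 1) j) ^ 2 + w.2 (Fin.natAdd (k + 1) j) ^ 2)) +
        w.1 (Fin.castAdd n (Fin.last k)) ^ 2 := by
  unfold prefixHostEnergy
  set S := ∑ j : Fin n, (w.1 (Fin.natAdd (k + 1) j) ^ 2 + w.2 (Fin.natAdd (k + 1) j) ^ 2) with hS
  have hS0 : 0 ≤ S := Finset.sum_nonneg fun j _ => by positivity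
  have hq2 : ∀ j : Fin n, w.1 (Fin.natAdd (k + 1) j) ^ 2 ≤ S := fun j => by
    rw [hS]
    refine le_trans ?_ (Finset.single_le_sum (f := fun j => w.1 (Fin.natAdd (k + 1) j) ^ 2 +
      w.2 (Fin.natAdd (k + 1) j) ^ 2) (fun j _ => by positivity) (Finset.mem_univ j))
    nlinarith [sq_nonneg (w.2 (Fin.natAdd (k + 1) j))]
  -- sites
  have h1 : ∑ j : Fin n, (w.2 (Fin.natAdd (k + 1) j) ^ 2 / 2 + ω₂ * w.1 (Fin.natAdd (k + 1) j) ^ 2 / 2) ≤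
      (ω₂ / 2 + 1 / 2) * S := by
    rw [hS, Finset.mul_sum]
    refine Finset.sum_le_sum fun j _ => ?_
    nlinarith [sq_nonneg (w.2 (Fin.natAdd (k + 1) j)), sq_nonneg (w.1 (Fin.natAdd (k + 1) j)), hω,
      mul_nonneg hω (sq_nonneg (w.2 (Fin.natAdd (k + 1) j)))]
  -- host bonds: `(a - b)²/2 ≤ a² + b²`
  have h2 : ∑ j : Fin n, (if h : j.val + 1 < n then
      (w.1 (Fin.natAdd (k + 1) ⟨j.val + 1, h⟩) - w.1 (Fin.natAdd (k + 1) j)) ^ 2 / 2 else 0) ≤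
      ∑ j : Fin n, ((if h : j.val + 1 < n then w.1 (Fin.natAdd (k + 1) ⟨j.val + 1, h⟩) ^ 2 else 0) +
        w.1 (Fin.natAdd (k + 1) j) ^ 2) := Finset.sum_le_sum fun j _ => by
    split_ifs with h
    · nlinarith [sq_nonneg (w.1 (Fin.natAdd (k + 1) ⟨j.val + 1, h⟩) + w.1 (Fin.natAdd (k + 1) j))]
    · positivity
  have h3 : ∑ j : Fin n, ((if h : j.val + 1 < n then w.1 (Fin.natAdd (k + 1) ⟨j.val + 1, h⟩) ^ 2 else 0) +
      w.1 (Fin.natAdd (k + 1) j) ^ 2) ≤ 2 * S := by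
    rw [Finset.sum_add_distrib, two_mul]
    refine add_le_add ?_ ?_
    · -- reindex the shifted squares into a sub-sum of `S`
      have e := hostBlock_sum_bond_reindex (n := n) (fun _ b => w.1 (Fin.natAdd (k + 1) b) ^ 2)
      rw [← e]
      rw [hS]
      exact Finset.sum_le_sum fun j _ => by
        split_ifs
        · nlinarith [sq_nonneg (w.2 (Fin.natAdd (k + 1) j))]
        · positivity
    · rw [hS]
      exact Finset.sum_le_sum fun j _ => by nlinarith [sq_nonneg (w.2 (Fin.natAdd (k + 1) j))]
  -- the interface bond
  have h4 : (if h : 0 < n then (w.1 (Fin.natAdd (k + 1) ⟨0, h⟩) - w.1 (Fin.castAdd n (Fin.last k))) ^ 2 / 2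
      else 0) ≤ S + w.1 (Fin.castAdd n (Fin.last k)) ^ 2 := by
    split_ifs with h
    · have := hq2 ⟨0, h⟩
      nlinarith [sq_nonneg (w.1 (Fin.natAdd (k + 1) ⟨0, h⟩) + w.1 (Fin.castAdd n (Fin.last k)))]
    · positivity
  linarith [h1, h2, h3, h4]

end Split

end Literature.MathematicalPhysics.KineticTheory.HeatConduction
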